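import Literature.NumberTheory.Automorphic.SatakeTransformModP
import Literature.NumberTheory.Automorphic.HeckeAlgebraBaseChange
import HarnessLib

/-!
# The Satake transform with coefficients commutes with change of coefficients: `𝒮_{R'}(ψ T) = f_*(𝒮_R(T))`
# (Gross, *On the Satake isomorphism*, §3; Treumann–Venkatesh §7.2, proof of Thm. (i))

Topic `NumberTheory/Automorphic`; namespace `Literature.NumberTheory.Automorphic` (lane `lit-hodgefound`, Track 2
foundations; seat `lit-hodgefound-p11`, generation 42, row g42-#9).  THEOREMS ONLY: no definition, no named fact, no
instance, no notation.  For a commutative ring `R` in which `q = #𝓀` is a unit and a commutative `R`-algebra `R'` (so `q`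
is a unit of `R'` too), the Satake transforms `𝒮_R = satakeTransformModP hϖ hq` and `𝒮_{R'}` of `SatakeTransformModP`
are compatible with the change of coefficients `ψ : ℋ_R(GL_n(F), GL_n(𝒪)) → ℋ_{R'}(GL_n(F), GL_n(𝒪))` of g42-#7
(`HeckeAlgebraBaseChange`: `(ψ T) [K] = f_*(T [K])`, `f = algebraMap R R'`) and the coefficientwise map
`f_* : R[ℤⁿ] → R'[ℤⁿ]`: **`𝒮_{R'}(ψ T) = f_*(𝒮_R T)`**.  With `R = ℤ[q⁻¹]` this is the statement that the (integrally
normalised) Satake transform is defined over `ℤ[q⁻¹]` and every `𝒮_{R'}` is deduced from it by extension of scalars.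

## The print

[GrossSatake1998] §3 («the Satake transform […] is defined over `ℤ[q^{1/2}, q^{-1/2}]` […]»; after the twist by
`|det|^{(n-1)/2}`, over `ℤ[q⁻¹]`); [TreumannVenkatesh2016] §7.2, proof of the Theorem, (i) (arXiv p. 21): «The `*`-action
of `W_{0,v}` […] leaves the subrings `ℤ'[X^*(Â_v)]` and `ℤ''[X^*(Â_v)]` stable, and (d) for `𝒮` implies that `𝒮^*` lies in
`ℤ''[X^*(Â_v)]`.  To conclude that `𝒮^*` is an isomorphism over `ℤ'` […]», `ℤ' = ℤ[q_v^{-1}]`; [CartierCorvallis1979]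
§IV (4.2) (the defining formula, whose coefficients are values of `f` times powers of `q`).

## What is formalised (theorems only)

* `isUnit_natCard_residueField_algebraMap` (`q ∈ Rˣ ⇒ q ∈ R'ˣ`), `map_unit_natCard_residueField`
  (`Units.map f (hq.unit) = hq'.unit`), `algebraMap_satakeWeightUnit` (`f(q^{-⟨ν, e⟩}) = q^{-⟨ν, e⟩}`),
* `map_satakeVecModP` (`f_*(satakeVecModP_R v) = satakeVecModP_{R'}(f_* v)` on `R[G ⧸ K]`),
* **`satakeTransformModP_apply_of_toVector_eq_map`** (`𝒮_{R'}(ψ T) = f_*(𝒮_R T)` for every change-of-coefficients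
  homomorphism `ψ` of g42-#7), **`exists_algHom_satakeTransformModP_comp`** (such a `ψ` exists, so the square commutes).

## References
* [GrossSatake1998] B. H. Gross, *On the Satake isomorphism* (1998), §3.
* [TreumannVenkatesh2016] D. Treumann, A. Venkatesh, *Functoriality, Smith theory, and the Brauer homomorphism*,
  Ann. of Math. 183 (2016), §7.2, proof of Thm. (i).
* [CartierCorvallis1979] P. Cartier, *Representations of 𝔭-adic groups: a survey*, PSPM 33.1 (1979), §IV (4.2).
-/

noncomputable section

open scoped MatrixGroups Pointwise
open ValuativeRel Matrix Finset MonoidAlgebra Representation MulAction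

namespace Literature.NumberTheory.Automorphic

section Naturality

variable {F : Type*} [Field F] [ValuativeRel F] {n : ℕ} [IsDiscreteValuationRing 𝒪[F]] {ϖ : F}
  {R R' : Type*} [CommRing R] [CommRing R'] [Algebra R R']

/-- If `q = #𝓀` is a unit of `R` it is a unit of every `R`-algebra `R'`. [folklore] [cite: GrossSatake1998, §3] -/
theorem isUnit_natCard_residueField_algebraMap (hq : IsUnit ((Nat.card 𝓀[F] : ℕ) : R)) :
    IsUnit ((Nat.card 𝓀[F] : ℕ) : R') := by
  have h := hq.map (algebraMap R R')
  rwa [map_natCast] at h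

/-- `f(q) = q` on units: `Units.map f (hq.unit) = hq'.unit`. [folklore] [cite: GrossSatake1998, §3] -/
theorem map_unit_natCard_residueField (hq : IsUnit ((Nat.card 𝓀[F] : ℕ) : R)) (hq' : IsUnit ((Nat.card 𝓀[F] : ℕ) : R')) :
    Units.map (algebraMap R R' : R →* R') hq.unit = hq'.unit :=
  Units.ext (by rw [Units.coe_map, IsUnit.unit_spec, IsUnit.unit_spec, MonoidHom.coe_coe, map_natCast])

/-- **The weight `q^{-⟨ν, e⟩}` is compatible with change of coefficients**: `f(q_R^{-⟨ν, e⟩}) = q_{R'}^{-⟨ν, e⟩}`.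
[cite: CartierCorvallis1979, §IV (4.2)] [cite: GrossSatake1998, §3] -/
theorem algebraMap_satakeWeightUnit (hq : IsUnit ((Nat.card 𝓀[F] : ℕ) : R)) (hq' : IsUnit ((Nat.card 𝓀[F] : ℕ) : R'))
    (e : Fin n → ℤ) :
    algebraMap R R' ((satakeWeightUnit hq.unit e : Rˣ) : R) = ((satakeWeightUnit hq'.unit e : R'ˣ) : R') := by
  rw [← MonoidHom.coe_coe, ← Units.coe_map, satakeWeightUnit, satakeWeightUnit, map_zpow,
    map_unit_natCard_residueField hq hq']

variable (hϖ : IsUniformizingElement ϖ) (hq : IsUnit ((Nat.card 𝓀[F] : ℕ) : R)) (hq' : IsUnit ((Nat.card 𝓀[F] : ℕ) : R'))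

/-- **`f_* ∘ satakeVecModP_R = satakeVecModP_{R'} ∘ f_*`** on `R[G ⧸ K]` (coefficientwise `f = algebraMap R R'`): both send
`[γ]` to `q^{-⟨ν, e(γ)⟩} x^{e(γ)}`. [cite: CartierCorvallis1979, §IV (4.2)] [cite: GrossSatake1998, §3] -/
theorem map_satakeVecModP (v : MonoidAlgebra R (GL (Fin n) F ⧸ glInt n F)) :
    AddMonoidAlgebra.map (algebraMap R R').toAddMonoidHom (satakeVecModP hϖ hq v) =
      satakeVecModP hϖ hq' (MonoidAlgebra.map (algebraMap R R').toAddMonoidHom v) := by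
  induction v using MonoidAlgebra.induction_linear with
  | zero => simp
  | add x y hx hy => rw [map_add, AddMonoidAlgebra.map_add, hx, hy, MonoidAlgebra.map_add, map_add]
  | single γ c =>
    rw [satakeVecModP_single, MonoidAlgebra.map_single, satakeVecModP_single, AddMonoidAlgebra.map_single,
      RingHom.toAddMonoidHom_eq_coe, AddMonoidHom.coe_coe, map_mul, algebraMap_satakeWeightUnit hq hq']

/-- **THE SATAKE TRANSFORM COMMUTES WITH CHANGE OF COEFFICIENTS**: for every change-of-coefficients homomorphism
`ψ : ℋ_R → ℋ_{R'}` (`(ψ T) [K] = f_*(T [K])`, g42-#7 `heckeAlgebra.exists_algHom_toVector_eq_map`),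
`𝒮_{R'}(ψ T) = f_*(𝒮_R(T))` — the transform with coefficients in `R'` is the extension of scalars of the one over `R`; for
`R = ℤ[q⁻¹]`, «`𝒮` is defined over `ℤ[q⁻¹]`». [cite: GrossSatake1998, §3] [cite: TreumannVenkatesh2016, §7.2, proof of Thm. (i)]
[cite: CartierCorvallis1979, §IV (4.2)] -/
theorem satakeTransformModP_apply_of_toVector_eq_map
    {ψ : heckeAlgebra R (GL (Fin n) F) (glInt n F) →ₐ[R] heckeAlgebra R' (GL (Fin n) F) (glInt n F)}
    (hψ : ∀ T, heckeAlgebra.toVector (glInt n F) (ψ T) =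
      MonoidAlgebra.map (algebraMap R R').toAddMonoidHom (heckeAlgebra.toVector (glInt n F) T))
    (T : heckeAlgebra R (GL (Fin n) F) (glInt n F)) :
    satakeTransformModP hϖ hq' (ψ T) =
      AddMonoidAlgebra.map (algebraMap R R').toAddMonoidHom (satakeTransformModP hϖ hq T) := by
  rw [satakeTransformModP_apply, satakeTransformModP_apply, hψ, map_satakeVecModP hϖ hq hq']

/-- **The square commutes**: there is a change-of-coefficients homomorphism `ψ : ℋ_R →ₐ[R] ℋ_{R'}` (fixing every
`T_{KgK}`, g42-#7) with `𝒮_{R'} ∘ ψ = f_* ∘ 𝒮_R`. [cite: GrossSatake1998, §3] [cite: TreumannVenkatesh2016, §7.2, proof of Thm. (i)] -/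
theorem exists_algHom_satakeTransformModP_comp :
    ∃ ψ : heckeAlgebra R (GL (Fin n) F) (glInt n F) →ₐ[R] heckeAlgebra R' (GL (Fin n) F) (glInt n F),
      (∀ T, heckeAlgebra.toVector (glInt n F) (ψ T) =
        MonoidAlgebra.map (algebraMap R R').toAddMonoidHom (heckeAlgebra.toVector (glInt n F) T)) ∧
      ∀ T, satakeTransformModP hϖ hq' (ψ T) =
        AddMonoidAlgebra.map (algebraMap R R').toAddMonoidHom (satakeTransformModP hϖ hq T) := by
  obtain ⟨ψ, hψ⟩ := heckeAlgebra.exists_algHom_toVector_eq_map (k := R) (k' := R') (glInt n F)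
  exact ⟨ψ, hψ, fun T => satakeTransformModP_apply_of_toVector_eq_map hϖ hq hq' hψ T⟩

variable [IsHeckeTriple (⊤ : Submonoid (GL (Fin n) F)) (glInt n F) (glInt n F)]

/-- On the double-coset basis: `𝒮_{R'}(T_{KgK}) = f_*(𝒮_R(T_{KgK}))` — the coefficients of the transform of a
double-coset operator are (images of) elements of `ℤ[q⁻¹]`. [cite: GrossSatake1998, §3]
[cite: TreumannVenkatesh2016, §7.2, proof of Thm. (i)] -/
theorem satakeTransformModP_doubleCosetOperator_eq_map (g : GL (Fin n) F) :
    satakeTransformModP hϖ hq' (heckeAlgebra.doubleCosetOperator (k := R') (glInt n F) g) =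
      AddMonoidAlgebra.map (algebraMap R R').toAddMonoidHom
        (satakeTransformModP hϖ hq (heckeAlgebra.doubleCosetOperator (k := R) (glInt n F) g)) := by
  obtain ⟨ψ, hψ, hS⟩ := exists_algHom_satakeTransformModP_comp hϖ hq hq'
  rw [← heckeAlgebra.apply_doubleCosetOperator_of_toVector_eq_map (glInt n F) hψ g, hS]

end Naturality

end Literature.NumberTheory.Automorphic

end
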